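import Mathlib
import HarnessLib
import Summits.Ventures.LatticeQCDFlow.Scoring.IMHAcceptanceRecordJumpPath
import Summits.Ventures.LatticeQCDFlow.Scoring.DoeblinSkeleton
import Summits.Ventures.LatticeQCDFlow.Exactness.DoeblinObservables

/-!
# The IMH acceptance record X: the accepted stream forgets its start geometrically —
# burn-in counted in acceptances, at the universal rate `1 − ā`

HONEST FRAMING: exact (Metropolis-corrected) sampling algorithms for lattice gauge theory; figures
of merit are autocorrelation/cost numbers at stated couplings and volumes; no continuum-physics
claim.  This file is value-free (no number of ours appears) and nothing in it is cited as a fact.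

NEW WORK (tree-internal).  IX (`IMHAcceptanceRecordJumpPath`) proved, for EVERY weight `w > 0`,
EVERY initial record law `μ̂₀` of the flow-MCMC record chain `Z_t = (X_t, A_t)` and every bounded
measurable functional `G` of the past `Z_{≤a}`, that the `(m+1)`-th accepted state after time `a`
is `J̃^{m+1}(X_a, ·)`-distributed given the past (`hasSum_kthAccept`; `J̃ = imhJump q w`, VII), and
VII proved the minorisation `J̃(x, ·) ≥ ā · π̃` with the CONSTANT `ā = ∫ α dπ` (`imhJump_doeblin`;
`π̃ = imhTilt q w π`, `J̃`-invariant).  IX's NOT-CLAIMED list named the every-start thermalisation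
of the accepted stream.  It is proved here.
* KERNEL LEVEL (§1; `w` measurable, `w > 0`, `w · q = π`): `(kop J̃)^[t] g (x) = ∫ g dJ̃ᵗ(x, ·)`
  (`iterate_kop_imhJump_eq_integral_nHit`) and, for EVERY start `x`, every `t`, every measurable
  `g` with values in `[0, 1]` and every set `S`:
  `|(kop J̃)^[t] g (x) − π̃(g)| ≤ (1 − ā)ᵗ` and `|J̃ᵗ(x, S) − π̃(S)| ≤ (1 − ā)ᵗ`
  (`abs_iterate_kop_imhJump_sub_le`, `abs_nHit_imhJump_real_sub_le`: VII's minorisation fed to the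
  tree's Doeblin lemmas `Exactness.doeblin_integral_nHit_sub_le` / `doeblin_nHit_sub_le`; no
  aperiodicity or irreducibility hypothesis and no spectral input on the base chain).
* PATH LEVEL (§2; every `μ̂₀`, every time `a`, every `m`, every bounded measurable `G` of `Z_{≤a}`):
  the `ℓ`-th-acceptance laws of IX have TOTAL MASS `E[G]` (`hasSum_kthAccept_one`: an `(m+1)`-th
  further acceptance happens, given any past), their set form `hasSum_kthAccept_real`, and
  THE BURN-IN THEOREM `abs_tsum_kthAccept_sub_le`:
  `|Σ_n E[G · 1{m acc. in a+1..a+n} · A_{a+1+n} g(X_{a+1+n})] − E[G] π̃(g)| ≤ (1 − ā)^{m+1} E|G|`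
  — the `(m+1)`-th accepted configuration after ANY time, jointly with ANY past event, is within
  `(1 − ā)^{m+1}` of the tilted target `π̃`: burn-in is counted in ACCEPTANCES and its rate is the
  mean acceptance, whatever the start.
* PROBABILITY FORM (§3, `G = 1`): the events "`m` acceptances among the moves `a+1..a+n`, move
  `a+1+n` accepted into `S`" have probabilities summing over `n` to within `(1 − ā)^{m+1}` of
  `π̃(S)` (`abs_tsum_prob_kthAccept_sub_le`), to exactly one for `S = Ω` (`hasSum_prob_kthAccept`),
  and almost every run accepts again and again after every time (`ae_forall_exists_kthAccept`).
* THE LATTICE INSTANCE (§4; hypotheses of VII's `flowSampler_jump_doeblin`: smooth action and flow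
  generator on `SU(n)^E`, flow-equation defect `≤ δ`, proposal `q = (Φ 1)_* D[V]`, `π` = Boltzmann):
  the accepted configurations of the exact flow sampler thermalise from EVERY start at rate
  `(1 − e^{−2δ})ᵗ` in the number `t` of acceptances, for sets and for `[0,1]`-valued observables
  (`flowSampler_jump_burnIn`).

PRINTED COUNTERPARTS, NAMED ONLY (nothing below is imported as a fact; labels by source, presearch
of record in the seat notes): the jump-chain representation of Metropolis–Hastings accepted states
[galaxy:pdf:-7173847574603489160 p.2, Lemma 1]; the accepted-state chain of the independence
sampler and its uniform ergodicity under a bounded weight [corpus:paper:arxiv-1910.13316 p.4 §3],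
[corpus:paper:arxiv-1609.02541 p.3; p.12 §6].  The statement with the MEAN acceptance `ā` as the
Doeblin constant of the jump chain of an ARBITRARY positive weight, and its path form counted in
acceptances from an arbitrary initial record law, are tree-internal (VII, IX, this file); no printed
source is claimed for them.

NOT CLAIMED: any number of ours; convergence of the time-`t` marginal of the base chain (that is
the `Exactness` Doeblin bound with the infimum of the acceptance mass, a different statement); a CLT
or concentration bound for accepted-stream averages; optimality of the rate `1 − ā`; anything about
the defect `δ` beyond VII's hypotheses.
-/

noncomputable section

namespace Summit.Ventures.LatticeQCDFlow.Scoring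

open MeasureTheory ProbabilityTheory Filter Finset Summit.Ventures.LatticeQCDFlow.Exactness
open scoped ENNReal Topology

/-! ### §0 Elementary facts on indicators and accept flags -/

namespace JumpBurnIn

/-- `0 ≤ 1_S`. -/
theorem indicator_one_nonneg {X : Type*} (S : Set X) (x : X) : 0 ≤ S.indicator (1 : X → ℝ) x :=
  Set.indicator_nonneg (fun _ _ => zero_le_one) x

/-- `1_S ≤ 1`. -/
theorem indicator_one_le_one {X : Type*} (S : Set X) (x : X) : S.indicator (1 : X → ℝ) x ≤ 1 := by
  by_cases h : x ∈ S <;> simp [h]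

/-- A `[0, 1]`-valued function is bounded by `1` in absolute value. -/
theorem abs_le_one_of_mem_Icc {X : Type*} {g : X → ℝ} (h0 : ∀ x, 0 ≤ g x) (h1 : ∀ x, g x ≤ 1)
    (x : X) : |g x| ≤ 1 := by
  rw [abs_of_nonneg (h0 x)]; exact h1 x

/-- `0 ≤ A`. -/
theorem acceptFlag_nonneg {X : Type*} (z : X × Bool) : 0 ≤ acceptFlag z := by
  unfold acceptFlag; split_ifs <;> norm_num

/-- `A = 1` on an accepted record. -/
theorem acceptFlag_eq_one {X : Type*} {z : X × Bool} (h : z.2 = true) : acceptFlag z = 1 := by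
  unfold acceptFlag; rw [if_pos h]

/-- The `(m+1)`-th acceptance after time `a` happens at most once: it cannot be both move `a+1+i`
and compatible with `m` acceptances among the first `j > i` moves. -/
theorem kthAccept_unique {X : Type*} {a m i j : ℕ} {x : ℕ → X × Bool} (hij : i < j)
    (hi : ∑ k ∈ range i, acceptFlag (x (a + 1 + k)) = m) (hA : (x (a + 1 + i)).2 = true)
    (hj : ∑ k ∈ range j, acceptFlag (x (a + 1 + k)) = m) : False := by
  have hmono : ∑ k ∈ range (i + 1), acceptFlag (x (a + 1 + k))
      ≤ ∑ k ∈ range j, acceptFlag (x (a + 1 + k)) :=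
    sum_le_sum_of_subset_of_nonneg (range_subset_range.2 (Nat.succ_le_of_lt hij))
      fun k _ _ => acceptFlag_nonneg _
  rw [sum_range_succ, hi, hj, acceptFlag_eq_one hA] at hmono
  linarith

/-- `1{m acc. among a+1..a+n} · A_{a+1+n} · 1_S(X_{a+1+n})` is the indicator of the event
"`m` acceptances among the moves `a+1..a+n`, move `a+1+n` accepted, into `S`". -/
theorem ind_mul_eq_indicator {X : Type*} (a n m : ℕ) (S : Set X) (x : ℕ → X × Bool) :
    JumpPath.ind a n m x * (acceptFlag (x (a + 1 + n)) * S.indicator 1 (x (a + 1 + n)).1)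
      = {x : ℕ → X × Bool | ∑ j ∈ range n, acceptFlag (x (a + 1 + j)) = m ∧
          (x (a + 1 + n)).2 = true ∧ (x (a + 1 + n)).1 ∈ S}.indicator 1 x := by
  classical
  have hA : acceptFlag (x (a + 1 + n)) = if (x (a + 1 + n)).2 = true then 1 else 0 := rfl
  rw [hA, JumpPath.ind]
  simp only [Set.indicator_apply, Set.mem_setOf_eq, Pi.one_apply]
  by_cases h1 : ∑ j ∈ range n, acceptFlag (x (a + 1 + j)) = (m : ℝ) <;>
  by_cases h2 : (x (a + 1 + n)).2 = true <;>
  by_cases h3 : (x (a + 1 + n)).1 ∈ S <;>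
  simp [h1, h2, h3]

variable {Ω : Type*} [MeasurableSpace Ω]

/-- The event "`m` acceptances among the moves `a+1..a+n`, move `a+1+n` accepted into `S`" is
measurable. -/
theorem measurableSet_kthAcceptIn {S : Set Ω} (hS : MeasurableSet S) (a n m : ℕ) :
    MeasurableSet {x : ℕ → Ω × Bool | ∑ j ∈ range n, acceptFlag (x (a + 1 + j)) = m ∧
      (x (a + 1 + n)).2 = true ∧ (x (a + 1 + n)).1 ∈ S} :=
  measurableSet_setOf.2 <|
    (measurableSet_setOf.1 <| measurableSet_eq_fun (Finset.measurable_sum _ fun _ _ =>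
        measurable_acceptFlag.comp (measurable_pi_apply _)) measurable_const).and <|
      (measurableSet_setOf.1 <| (measurable_snd.comp (measurable_pi_apply (a + 1 + n)))
          (measurableSet_singleton true)).and
        (measurableSet_setOf.1 <| (measurable_fst.comp (measurable_pi_apply (a + 1 + n))) hS)

end JumpBurnIn

variable {Ω : Type*} [MeasurableSpace Ω] {q : Measure Ω} [IsProbabilityMeasure q] {w : Ω → ℝ}
  {π : Measure Ω}

/-! ### §1 Kernel level: the jump chain thermalises from every start at rate `1 − ā` -/

/-- `(kop J̃)^[t] g (x) = ∫ g dJ̃ᵗ(x, ·)` for bounded measurable `g`: the iterated jump operator is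
integration against the `t`-step jump kernel `nHit (imhJump q w) t`. -/
theorem iterate_kop_imhJump_eq_integral_nHit (hw : Measurable w) (hw0 : ∀ x, 0 < w x)
    {g : Ω → ℝ} (hg : Measurable g) {C : ℝ} (hC : ∀ x, |g x| ≤ C) (t : ℕ) (x : Ω) :
    (kop (imhJump q w))^[t] g x = ∫ y, g y ∂(nHit (imhJump q w) t x) := by
  haveI := isMarkovKernel_imhJump (q := q) hw hw0
  rw [← kop_nHit (imhJump q w) t hg hC]
  rfl

/-- Set form: `(kop J̃)^[t] 1_S (x) = J̃ᵗ(x, S)`. -/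
theorem iterate_kop_imhJump_indicator (hw : Measurable w) (hw0 : ∀ x, 0 < w x) {S : Set Ω}
    (hS : MeasurableSet S) (t : ℕ) (x : Ω) :
    (kop (imhJump q w))^[t] (S.indicator 1) x = (nHit (imhJump q w) t x).real S := by
  rw [iterate_kop_imhJump_eq_integral_nHit hw hw0 (measurable_one.indicator hS)
    (JumpBurnIn.abs_le_one_of_mem_Icc (JumpBurnIn.indicator_one_nonneg S)
      (JumpBurnIn.indicator_one_le_one S)) t x, integral_indicator_one hS]

/-- **EVERY-START GEOMETRIC THERMALISATION OF THE JUMP CHAIN, OBSERVABLES** (`w` measurable,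
`w > 0`, `w · q = π`; every start `x`, every `t`, every measurable `g` with values in `[0, 1]`):
`|(kop J̃)^[t] g (x) − ∫ g dπ̃| ≤ (1 − ā)ᵗ`, `ā = ∫ α dπ`, `π̃ = imhTilt q w π`. -/
theorem abs_iterate_kop_imhJump_sub_le (hw : Measurable w) (hw0 : ∀ x, 0 < w x)
    [IsProbabilityMeasure π] (hπ : (q.withDensity fun x => ENNReal.ofReal (w x)) = π)
    {g : Ω → ℝ} (hg : Measurable g) (hg0 : ∀ x, 0 ≤ g x) (hg1 : ∀ x, g x ≤ 1) (t : ℕ) (x : Ω) :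
    |(kop (imhJump q w))^[t] g x - ∫ y, g y ∂(imhTilt q w π)|
      ≤ (1 - (∫⁻ y, imhAcceptMass q w y ∂π).toReal) ^ t := by
  haveI := isMarkovKernel_imhJump (q := q) hw hw0
  haveI := isProbabilityMeasure_imhTilt (q := q) (π := π) hw hw0
  rw [iterate_kop_imhJump_eq_integral_nHit hw hw0 hg (JumpBurnIn.abs_le_one_of_mem_Icc hg0 hg1)]
  exact doeblin_integral_nHit_sub_le (fun y B hB => imhJump_doeblin hw hw0 hπ y hB)
    (lintegral_imhAcceptMass_le_one π) (imhJump_invariant hw hw0 hπ) x t hg hg0 hg1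

/-- **EVERY-START GEOMETRIC THERMALISATION OF THE JUMP CHAIN, SETS** (same hypotheses; every
start `x`, every `t`, every set `S`): `|J̃ᵗ(x, S) − π̃(S)| ≤ (1 − ā)ᵗ`. -/
theorem abs_nHit_imhJump_real_sub_le (hw : Measurable w) (hw0 : ∀ x, 0 < w x)
    [IsProbabilityMeasure π] (hπ : (q.withDensity fun x => ENNReal.ofReal (w x)) = π)
    (t : ℕ) (x : Ω) (S : Set Ω) :
    |(nHit (imhJump q w) t x).real S - (imhTilt q w π).real S|
      ≤ (1 - (∫⁻ y, imhAcceptMass q w y ∂π).toReal) ^ t := by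
  haveI := isMarkovKernel_imhJump (q := q) hw hw0
  haveI := isProbabilityMeasure_imhTilt (q := q) (π := π) hw hw0
  exact doeblin_nHit_sub_le (fun y B hB => imhJump_doeblin hw hw0 hπ y hB)
    (lintegral_imhAcceptMass_le_one π) (imhJump_invariant hw hw0 hπ) x t S

/-! ### §2 Path level: the `(m+1)`-th accepted state after any time, given any past -/

section Path
variable [Fact (Measurable w)]

/-- **THE `ℓ`-TH-ACCEPTANCE LAW HAS TOTAL MASS `E[G]`** (any initial record law `μ̂₀`, any time
`a`, any `m`, any bounded measurable `G` depending on `Z_{≤a}`):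
`Σ_n E[G · 1{m acc. among a+1..a+n} · A_{a+1+n}] = E[G]` — an `(m+1)`-th further acceptance
happens, jointly with any past event, with full probability. -/
theorem hasSum_kthAccept_one (hw0 : ∀ x, 0 < w x) (μ₀ : Measure (Ω × Bool))
    [IsProbabilityMeasure μ₀] (a m : ℕ) {G : (ℕ → Ω × Bool) → ℝ} (hG : Measurable G)
    (hGd : DependsOn G (Set.Iic a)) {CG : ℝ} (hCG : ∀ x, |G x| ≤ CG) :
    HasSum (fun n => ∫ x, G x * (JumpPath.ind a n m x * acceptFlag (x (a + 1 + n)))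
        ∂(JumpPath.recordPath q w μ₀)) (∫ x, G x ∂(JumpPath.recordPath q w μ₀)) := by
  have hw : Measurable w := Fact.out
  haveI := isMarkovKernel_imhJump (q := q) hw hw0
  have h := hasSum_kthAccept (q := q) hw0 μ₀ (g := fun _ => (1 : ℝ)) measurable_const
    (fun _ => zero_le_one) (Cg := 1) (fun _ => by simp) a m hG hGd hCG
  rw [Function.iterate_fixed (kop_const (κ := imhJump q w) 1) (m + 1)] at h
  simpa only [mul_one] using h

/-- **… AND ITS SET FORM IS THE `(m+1)`-STEP JUMP KERNEL** (same data, measurable `S`):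
`Σ_n E[G · 1{m acc. among a+1..a+n} · A_{a+1+n} · 1_S(X_{a+1+n})] = E[G · J̃^{m+1}(X_a, S)]`. -/
theorem hasSum_kthAccept_real (hw0 : ∀ x, 0 < w x) (μ₀ : Measure (Ω × Bool))
    [IsProbabilityMeasure μ₀] {S : Set Ω} (hS : MeasurableSet S) (a m : ℕ)
    {G : (ℕ → Ω × Bool) → ℝ} (hG : Measurable G) (hGd : DependsOn G (Set.Iic a)) {CG : ℝ}
    (hCG : ∀ x, |G x| ≤ CG) :
    HasSum (fun n => ∫ x, G x * (JumpPath.ind a n m x * (acceptFlag (x (a + 1 + n))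
        * S.indicator 1 (x (a + 1 + n)).1)) ∂(JumpPath.recordPath q w μ₀))
      (∫ x, G x * (nHit (imhJump q w) (m + 1) (x a).1).real S ∂(JumpPath.recordPath q w μ₀)) := by
  have hw : Measurable w := Fact.out
  have h := hasSum_kthAccept (q := q) hw0 μ₀ (g := S.indicator 1) (measurable_one.indicator hS)
    (JumpBurnIn.indicator_one_nonneg S) (Cg := 1) (JumpBurnIn.abs_le_one_of_mem_Icc
      (JumpBurnIn.indicator_one_nonneg S) (JumpBurnIn.indicator_one_le_one S)) a m hG hGd hCG
  simpa only [iterate_kop_imhJump_indicator hw hw0 hS] using h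

/-- **THE BURN-IN THEOREM OF THE ACCEPTED STREAM** (`w · q = π`; any initial record law `μ̂₀`,
any time `a`, any `m`, any bounded measurable `G` depending on `Z_{≤a}`, any measurable `g` with
values in `[0, 1]`):
`|Σ_n E[G · 1{m acc. among a+1..a+n} · A_{a+1+n} g(X_{a+1+n})] − E[G] ∫ g dπ̃| ≤ (1 − ā)^{m+1} E|G|`
— the `(m+1)`-th accepted state after any time, jointly with any past event, is
`(1 − ā)^{m+1}`-close to the tilted target `π̃ = imhTilt q w π`, whatever the start. -/
theorem abs_tsum_kthAccept_sub_le (hw0 : ∀ x, 0 < w x) [IsProbabilityMeasure π]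
    (hπ : (q.withDensity fun x => ENNReal.ofReal (w x)) = π)
    (μ₀ : Measure (Ω × Bool)) [IsProbabilityMeasure μ₀]
    {g : Ω → ℝ} (hg : Measurable g) (hg0 : ∀ x, 0 ≤ g x) (hg1 : ∀ x, g x ≤ 1) (a m : ℕ)
    {G : (ℕ → Ω × Bool) → ℝ} (hG : Measurable G) (hGd : DependsOn G (Set.Iic a))
    {CG : ℝ} (hCG : ∀ x, |G x| ≤ CG) :
    |∑' n, ∫ x, G x * (JumpPath.ind a n m x * (acceptFlag (x (a + 1 + n))
          * g (x (a + 1 + n)).1)) ∂(JumpPath.recordPath q w μ₀)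
        - (∫ x, G x ∂(JumpPath.recordPath q w μ₀)) * ∫ y, g y ∂(imhTilt q w π)|
      ≤ (1 - (∫⁻ y, imhAcceptMass q w y ∂π).toReal) ^ (m + 1)
          * ∫ x, |G x| ∂(JumpPath.recordPath q w μ₀) := by
  have hw : Measurable w := Fact.out
  haveI := isMarkovKernel_imhJump (q := q) hw hw0
  have hC : ∀ y, |g y| ≤ 1 := JumpBurnIn.abs_le_one_of_mem_Icc hg0 hg1
  obtain ⟨hKm, hKb⟩ := iterate_kop_bounded_measurable (imhJump q w) hg hC (m + 1)
  have hIG : Integrable G (JumpPath.recordPath q w μ₀) := integrable_of_bounded _ hG hCG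
  have hI1 : Integrable (fun x => G x * (kop (imhJump q w))^[m + 1] g (x a).1)
      (JumpPath.recordPath q w μ₀) :=
    integrable_of_bounded _ (hG.mul (hKm.comp (measurable_fst.comp (measurable_pi_apply a))))
      (C := CG * 1) fun x => by
        rw [abs_mul]
        exact mul_le_mul (hCG x) (hKb _) (abs_nonneg _) ((abs_nonneg _).trans (hCG x))
  rw [(hasSum_kthAccept hw0 μ₀ hg hg0 hC a m hG hGd hCG).tsum_eq, ← integral_mul_const,
    ← integral_sub hI1 (hIG.mul_const _)]
  refine abs_integral_le_integral_abs.trans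
    ((integral_mono (hI1.sub (hIG.mul_const _)).abs (hIG.abs.const_mul _) fun x => ?_).trans_eq
      (integral_const_mul _ _))
  rw [Pi.sub_apply, ← mul_sub, abs_mul]
  exact (mul_comm _ _).trans_le (mul_le_mul_of_nonneg_right
    (abs_iterate_kop_imhJump_sub_le hw hw0 hπ hg hg0 hg1 (m + 1) (x a).1) (abs_nonneg _))

/-! ### §3 Probability form -/

/-- The summands of the `ℓ`-th-acceptance law at `G = 1`, `g = 1_S` are the probabilities of the
events "`m` acceptances among the moves `a+1..a+n`, move `a+1+n` accepted into `S`". -/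
theorem integral_kthAcceptIn_eq_real (μ₀ : Measure (Ω × Bool)) [IsProbabilityMeasure μ₀]
    {S : Set Ω} (hS : MeasurableSet S) (a n m : ℕ) :
    ∫ x, JumpPath.ind a n m x * (acceptFlag (x (a + 1 + n)) * S.indicator 1 (x (a + 1 + n)).1)
        ∂(JumpPath.recordPath q w μ₀)
      = (JumpPath.recordPath q w μ₀).real {x | ∑ j ∈ range n, acceptFlag (x (a + 1 + j)) = m ∧
          (x (a + 1 + n)).2 = true ∧ (x (a + 1 + n)).1 ∈ S} := by
  rw [← integral_indicator_one (JumpBurnIn.measurableSet_kthAcceptIn hS a n m)]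
  exact integral_congr_ae (ae_of_all _ fun x => JumpBurnIn.ind_mul_eq_indicator a n m S x)

/-- **PROBABILITY FORM OF THE BURN-IN THEOREM** (`w · q = π`; any initial record law, any time
`a`, any `m`, measurable `S`):
`|Σ_n P̂[m acc. among a+1..a+n, A_{a+1+n} = 1, X_{a+1+n} ∈ S] − π̃(S)| ≤ (1 − ā)^{m+1}`. -/
theorem abs_tsum_prob_kthAccept_sub_le (hw0 : ∀ x, 0 < w x) [IsProbabilityMeasure π]
    (hπ : (q.withDensity fun x => ENNReal.ofReal (w x)) = π)
    (μ₀ : Measure (Ω × Bool)) [IsProbabilityMeasure μ₀] {S : Set Ω} (hS : MeasurableSet S)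
    (a m : ℕ) :
    |∑' n, (JumpPath.recordPath q w μ₀).real {x | ∑ j ∈ range n, acceptFlag (x (a + 1 + j)) = m ∧
          (x (a + 1 + n)).2 = true ∧ (x (a + 1 + n)).1 ∈ S} - (imhTilt q w π).real S|
      ≤ (1 - (∫⁻ y, imhAcceptMass q w y ∂π).toReal) ^ (m + 1) := by
  have h := abs_tsum_kthAccept_sub_le (q := q) hw0 hπ μ₀ (measurable_one.indicator hS)
    (JumpBurnIn.indicator_one_nonneg S) (JumpBurnIn.indicator_one_le_one S) a m
    (G := fun _ => (1 : ℝ)) measurable_const (fun _ _ _ => rfl) (CG := 1) (fun _ => by simp)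
  simpa only [one_mul, integral_kthAcceptIn_eq_real μ₀ hS, integral_indicator_one hS,
    integral_const, abs_one, smul_eq_mul, mul_one, probReal_univ] using h

/-- **AN `(m+1)`-TH FURTHER ACCEPTANCE HAPPENS WITH PROBABILITY ONE** (any weight `w > 0`, any
initial record law, any time `a`, any `m`):
`Σ_n P̂[m acc. among a+1..a+n, A_{a+1+n} = 1] = 1`. -/
theorem hasSum_prob_kthAccept (hw0 : ∀ x, 0 < w x) (μ₀ : Measure (Ω × Bool))
    [IsProbabilityMeasure μ₀] (a m : ℕ) :
    HasSum (fun n => (JumpPath.recordPath q w μ₀).real {x |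
        ∑ j ∈ range n, acceptFlag (x (a + 1 + j)) = m ∧ (x (a + 1 + n)).2 = true}) 1 := by
  have hw : Measurable w := Fact.out
  haveI := isMarkovKernel_imhJump (q := q) hw hw0
  haveI := isMarkovKernel_nHit (imhJump q w) (m + 1)
  have h := hasSum_kthAccept_real (q := q) hw0 μ₀ MeasurableSet.univ a m
    (G := fun _ => (1 : ℝ)) measurable_const (fun _ _ _ => rfl) (CG := 1) (fun _ => by simp)
  simpa only [one_mul, integral_kthAcceptIn_eq_real μ₀ MeasurableSet.univ, Set.mem_univ,
    and_true, probReal_univ, integral_const, smul_eq_mul, mul_one] using h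

/-- **ALMOST EVERY RUN ACCEPTS AGAIN AND AGAIN** (any weight `w > 0`, any initial record law,
any time `a`): almost surely, for every `m` some move after time `a` is the `(m+1)`-th further
acceptance — the accepted stream is infinite. -/
theorem ae_forall_exists_kthAccept (hw0 : ∀ x, 0 < w x) (μ₀ : Measure (Ω × Bool))
    [IsProbabilityMeasure μ₀] (a : ℕ) :
    ∀ᵐ x ∂(JumpPath.recordPath q w μ₀), ∀ m : ℕ, ∃ n : ℕ,
      ∑ j ∈ range n, acceptFlag (x (a + 1 + j)) = m ∧ (x (a + 1 + n)).2 = true := by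
  rw [ae_all_iff]
  intro m
  have hE : ∀ n, MeasurableSet {x : ℕ → Ω × Bool |
      ∑ j ∈ range n, acceptFlag (x (a + 1 + j)) = m ∧ (x (a + 1 + n)).2 = true} := fun n => by
    simpa only [Set.mem_univ, and_true] using
      JumpBurnIn.measurableSet_kthAcceptIn (MeasurableSet.univ : MeasurableSet (Set.univ : Set Ω))
        a n m
  have hdisj : Pairwise (Function.onFun Disjoint fun n => {x : ℕ → Ω × Bool |
      ∑ j ∈ range n, acceptFlag (x (a + 1 + j)) = m ∧ (x (a + 1 + n)).2 = true}) := by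
    intro i j hij
    rcases lt_or_gt_of_ne hij with h | h
    · exact Set.disjoint_left.2 fun x hi hj => JumpBurnIn.kthAccept_unique h hi.1 hi.2 hj.1
    · exact Set.disjoint_right.2 fun x hj hi => JumpBurnIn.kthAccept_unique h hj.1 hj.2 hi.1
  have h1 : (JumpPath.recordPath q w μ₀) (⋃ n, {x : ℕ → Ω × Bool |
      ∑ j ∈ range n, acceptFlag (x (a + 1 + j)) = m ∧ (x (a + 1 + n)).2 = true}) = 1 := by
    rw [measure_iUnion hdisj hE]
    refine (ENNReal.toReal_eq_one_iff _).1 ?_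
    rw [ENNReal.tsum_toReal_eq fun n => measure_ne_top _ _]
    exact (hasSum_prob_kthAccept (q := q) hw0 μ₀ a m).tsum_eq
  filter_upwards [(mem_ae_iff_prob_eq_one (MeasurableSet.iUnion hE)).2 h1] with x hx
  simpa only [Set.mem_iUnion, Set.mem_setOf_eq] using hx

end Path

/-! ### §4 The lattice instance -/

section Lattice
open Literature.MathematicalPhysics.QuantumFieldTheory
open Literature.MathematicalPhysics.QuantumFieldTheory.Luscher2010
open Summit.Ventures.LatticeQCDFlow.TrivializingMaps
open scoped Matrix Matrix.Norms.Frobenius ContDiff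
variable {d L n : ℕ} [NeZero L]

/-- **THE ACCEPTED CONFIGURATIONS OF AN EXACT FLOW SAMPLER ON `SU(n)^E` THERMALISE FROM EVERY
START, AT RATE `(1 − e^{−2δ})ᵗ` IN THE NUMBER `t` OF ACCEPTANCES** (hypotheses of VII's
`flowSampler_jump_doeblin`; `q = (Φ 1)_* D[V]`, `π` = Boltzmann, `π̃ = imhTilt q w π`): a measurable
weight `w > 0` with `w · q = π` such that for every start `U`, every `t`, every set `A` and every
measurable `[0,1]`-valued `g`: `|J̃ᵗ(U, A) − π̃(A)| ≤ (1 − e^{−2δ})ᵗ` and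
`|(kop J̃)^[t] g (U) − ∫ g dπ̃| ≤ (1 − e^{−2δ})ᵗ`. -/
theorem flowSampler_jump_burnIn (B : SuBasis n)
    {S : AmbConfig d L n → ℝ} (hS : ContDiff ℝ ∞ S) {F : ℝ → AmbConfig d L n → ℝ}
    (hF : ContDiff ℝ ∞ fun p : ℝ × AmbConfig d L n => F p.1 p.2)
    {Φ} (hΦ : IsFlowMap (fun t W => -linkGrad B (F t) W) Φ) {c : ℝ → ℝ} {δ : ℝ}
    (hδ : ∀ t ∈ Set.Icc (0 : ℝ) 1, ∀ U : GaugeConfig d L (Matrix.specialUnitaryGroup (Fin n) ℂ),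
      |luscherL B S t (F t) (WilsonFlow.coeConfig U) - S (WilsonFlow.coeConfig U) - c t| ≤ δ)
    (q : Measure (GaugeConfig d L (Matrix.specialUnitaryGroup (Fin n) ℂ))) [IsProbabilityMeasure q]
    (hq : q = Measure.map (Φ 1) (trivialMeasure (Matrix.specialUnitaryGroup (Fin n) ℂ) d L))
    {π : Measure (GaugeConfig d L (Matrix.specialUnitaryGroup (Fin n) ℂ))} [IsProbabilityMeasure π]
    (hπB : π = boltzmannMeasure fun U => S (WilsonFlow.coeConfig U)) :
    ∃ w : GaugeConfig d L (Matrix.specialUnitaryGroup (Fin n) ℂ) → ℝ, Measurable w ∧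
      (∀ U, 0 < w U) ∧ (q.withDensity fun U => ENNReal.ofReal (w U)) = π ∧
      ∀ (U : GaugeConfig d L (Matrix.specialUnitaryGroup (Fin n) ℂ)) (t : ℕ),
        (∀ A : Set (GaugeConfig d L (Matrix.specialUnitaryGroup (Fin n) ℂ)),
          |(nHit (imhJump q w) t U).real A - (imhTilt q w π).real A|
            ≤ (1 - Real.exp (-(2 * δ))) ^ t) ∧
        ∀ {g : GaugeConfig d L (Matrix.specialUnitaryGroup (Fin n) ℂ) → ℝ}, Measurable g →
          (∀ V, 0 ≤ g V) → (∀ V, g V ≤ 1) →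
          |(kop (imhJump q w))^[t] g U - ∫ V, g V ∂(imhTilt q w π)|
            ≤ (1 - Real.exp (-(2 * δ))) ^ t := by
  subst hπB
  obtain ⟨w, hw, hlo, -, hπ, -, hα, -⟩ := flowSampler_exact_doeblin B hS hF hΦ hδ q hq
  have hw0 : ∀ U, 0 < w U := fun U => (Real.exp_pos _).trans_le (hlo U)
  have hle1 := lintegral_imhAcceptMass_le_one (q := q) (w := w)
    (boltzmannMeasure fun U : GaugeConfig d L (Matrix.specialUnitaryGroup (Fin n) ℂ) =>
      S (WilsonFlow.coeConfig U))
  have h0 : 0 ≤ 1 - (∫⁻ V, imhAcceptMass q w V ∂(boltzmannMeasure fun U :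
      GaugeConfig d L (Matrix.specialUnitaryGroup (Fin n) ℂ) =>
        S (WilsonFlow.coeConfig U))).toReal :=
    sub_nonneg.2 (ENNReal.toReal_le_of_le_ofReal zero_le_one (by rwa [ENNReal.ofReal_one]))
  have hr : 1 - (∫⁻ V, imhAcceptMass q w V ∂(boltzmannMeasure fun U :
      GaugeConfig d L (Matrix.specialUnitaryGroup (Fin n) ℂ) =>
        S (WilsonFlow.coeConfig U))).toReal ≤ 1 - Real.exp (-(2 * δ)) := by
    refine sub_le_sub_left ((ENNReal.ofReal_le_iff_le_toReal
      (ne_top_of_le_ne_top ENNReal.one_ne_top hle1)).1 ?_) 1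
    refine Eq.trans_le ?_ (lintegral_mono hα)
    rw [lintegral_const, measure_univ, mul_one]
  exact ⟨w, hw, hw0, hπ, fun U t =>
    ⟨fun A => (abs_nHit_imhJump_real_sub_le hw hw0 hπ t U A).trans (pow_le_pow_left₀ h0 hr t),
      fun hg hg0 hg1 => (abs_iterate_kop_imhJump_sub_le hw hw0 hπ hg hg0 hg1 t U).trans
        (pow_le_pow_left₀ h0 hr t)⟩⟩

end Lattice

end Summit.Ventures.LatticeQCDFlow.Scoring
end
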